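/-
Copyright (c) 2026 the pub-hodgecm-mathlib formalisation cell (harness21).  Prover seat hodgecm-mathlib-K2E1-p03 (g0), Track B ∕ K2-LIT
(build stream 29), h413 = `stmt-HodgeConjecture-24833`, line `K2_E1_TraceFormulaBeta`, `[L⁺:ℚ] = 1` TRANSPORT package, file 2 (dealer K2E1-plan (g0)
BY-NAME DEAL 2026-09-03T21:12:14Z): «p and 2 split in ℚ(√d)» in p-adic currency.  2026-09-03.
-/
import Mathlib.NumberTheory.Padics.Hensel        -- `hensels_lemma`
import Mathlib.Algebra.Squarefree.Basic          -- `Squarefree` (hypothesis of the dealt signature)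
import HarnessLib

/-!
# h413 ∕ Track B «K2-LIT», line `K2_E1_TraceFormulaBeta`, TRANSPORT package file 2: `d ≡ 1 (mod 8p)` IS A SQUARE IN `ℚ_p` AND IN `ℚ_2`
# (helper `K2E1RealQuadraticSplitAtP`, dealt BY NAME by K2E1-plan (g0) on `K2/STATUS.md` 2026-09-03T21:12:14Z; input of HELD row 21 `K2E1TransportRealQuadratic`)

Cell `pub/hodgecm-mathlib`, crux H413 = `stmt-HodgeConjecture-24833`, route of record `HCCMUnconditional`; chair K2-lead (g0), dealer K2E1-plan (g0).
THEOREMS ONLY (no `def`, no `instance`, no `notation`, no named-fact hypothesis, no `sorry`); imports = Mathlib + HarnessLib;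
lane `--supports stmt-HodgeConjecture-24833 --as helper` (count-neutral).

THE DEALT SIGNATURE (verbatim from the bus): `∀ p d : ℕ, p.Prime → Squarefree d → d ≡ 1 [MOD 8 * p] → IsSquare ((d : ℕ) : ℚ_[p]) ∧ IsSquare ((d : ℕ) : ℚ_[2])`.
TYPING NOTE.  Mathlib's `ℚ_[p] = Padic p` takes the primality of `p` as the INSTANCE `[Fact p.Prime]`; a bare hypothesis `p.Prime →` is invisible to
instance search, so the dictated bytes do not elaborate.  The main theorem `RealQuadraticSplitAtP` therefore binds `[Fact p.Prime] →` (the same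
statement: `Fact.out` ∕ `⟨hp⟩` each way), and `RealQuadraticSplitAtP'` is the literal `(hp : p.Prime) →` reading with the instance supplied inside the
type by `haveI`.  `Squarefree d` is idle for this conclusion and kept because it was dealt (it matters for `ℚ(√d)` being a quadratic FIELD, row 21).

THE MATHEMATICS («`p` and `2` split in the real quadratic field `ℚ(√d)`», i.e. `d ∈ (ℚ_p^×)²` and `d ∈ (ℚ_2^×)²`).  ONE uniform Hensel step: for a prime `q`
and `4q ∣ d − 1` (which `8p ∣ d − 1` gives both for `q = p` — `4p ∣ 8p` — and for `q = 2` — `8 ∣ 8p`), in `ℤ_q` one has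
`‖d − 1‖_q ≤ ‖4q‖_q = ‖2‖_q² · q⁻¹ < ‖2‖_q²`, and `F = X² − d`, `a = 1` satisfy `‖F(1)‖ = ‖d − 1‖ < ‖F′(1)‖² = ‖2‖²`, so Hensel's lemma
(Mathlib `hensels_lemma`, the Newton–Kurschák form valid at `q = 2` too) gives `z ∈ ℤ_q` with `z² = d`; hence `d` is a square in `ℚ_q ⊇ ℤ_q`.
(For odd `p` this is the classical «a unit which is a non-zero square mod `p` is a square in `ℤ_p`»; for `q = 2` it is «a unit `≡ 1 (mod 8)` is a
square in `ℤ_2`» [Serre, Cours d'arithmétique, II §3.3 Thm. 3–4] — folklore.)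

* §1 `norm_natCast_sub_one_lt`            · `4q ∣ d − 1 ⇒ ‖(d : ℤ_[q]) − 1‖ < ‖(2 : ℤ_[q])‖²`;
* §1 `isSquare_padic_natCast_of_dvd`      · `4q ∣ d − 1 ⇒ IsSquare (d : ℚ_[q])` (Hensel at `X² − d`, `a = 1`);
* §2 **`RealQuadraticSplitAtP`**          · the dealt statement with the instance binder `[Fact p.Prime]`;
* §2 `RealQuadraticSplitAtP'`             · the dealt statement with the literal binder `(hp : p.Prime)` (instance by `haveI` inside the type).

WHAT IS NOT HERE.  The passage from «`d` is a `q`-adic square» to «`q` splits in `ℚ(√d)`» in Mathlib's `NumberField` ∕ `IsDedekindDomain.HeightOneSpectrum`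
language (two places of `ℚ(√d)` over `q`, each with completion `ℚ_q`), and the compositum bookkeeping `L ↦ L·ℚ(√d)` — HELD row 21
`K2E1TransportRealQuadratic` behind its DEFS leaf (dealer's table `Lines/K2_E1_TraceFormulaBetaSigs_TABLE.md`).

HONEST LABEL.  HC_CM is proved only modulo the 7 printed citations (2 remaining named inputs: hLiu418 = `stmt-HodgeConjecture-24832`, h413 =
`stmt-HodgeConjecture-24833`) until rung 0 closes; this file moves no counter.

## References
* J.-P. Serre, *A Course in Arithmetic*, GTM 7 (1973), Ch. II §3.3 Thm. 3–4 (squares in `ℚ_p^×`; folklore here, proved via Mathlib's Hensel).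
* [Rogawski1990] J. Rogawski, *Automorphic representations of unitary groups in three variables*, Ann. of Math. Stud. 123 (1990), §13.8 p. 218
  (the regime the transport serves; context only).
* Mathlib `Mathlib/NumberTheory/Padics/Hensel.lean` (`hensels_lemma`).
-/

set_option autoImplicit false
-- the mandated namespace repeats the single-problem summit's segment (`HodgeConjecture.HodgeConjecture`)
set_option linter.dupNamespace false

namespace Summit.HodgeConjecture.HodgeConjecture.Cruxes.H413.K2E1RealQuadraticSplitAtP

open Polynomial

/-! ## §1 One uniform Hensel step in `ℤ_[q]` -/

/-- **Norm estimate.**  If `4q ∣ d − 1` (as integers) then `‖(d : ℤ_[q]) − 1‖ < ‖(2 : ℤ_[q])‖²`: indeed `‖d − 1‖ = ‖4q·k‖ = ‖2‖²·q⁻¹·‖k‖`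
with `‖k‖ ≤ 1` and `q⁻¹ < 1`, while `‖2‖ ≠ 0` (`ℤ_[q]` has characteristic zero).  [folklore] -/
theorem norm_natCast_sub_one_lt {q : ℕ} [Fact q.Prime] {d : ℕ} (h : (4 * (q : ℤ)) ∣ (d : ℤ) - 1) :
    ‖(d : ℤ_[q]) - 1‖ < ‖(2 : ℤ_[q])‖ ^ 2 := by
  obtain ⟨k, hk⟩ := h
  have hq : (q : ℝ)⁻¹ < 1 := inv_lt_one_of_one_lt₀ (by exact_mod_cast (Fact.out : q.Prime).one_lt)
  have hcast : (d : ℤ_[q]) - 1 = (((d : ℤ) - 1 : ℤ) : ℤ_[q]) := by push_cast; rfl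
  have h2 : (0 : ℝ) < ‖(2 : ℤ_[q])‖ ^ 2 := by
    have : (2 : ℤ_[q]) ≠ 0 := two_ne_zero
    positivity
  have h4 : ‖(4 : ℤ_[q])‖ = ‖(2 : ℤ_[q])‖ ^ 2 := by
    rw [show (4 : ℤ_[q]) = 2 * 2 by norm_num, norm_mul, sq]
  rw [hcast, hk]
  push_cast
  rw [norm_mul, norm_mul, h4, PadicInt.norm_p, mul_assoc]
  calc ‖(2 : ℤ_[q])‖ ^ 2 * ((q : ℝ)⁻¹ * ‖(k : ℤ_[q])‖)
      ≤ ‖(2 : ℤ_[q])‖ ^ 2 * ((q : ℝ)⁻¹ * 1) := by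
        gcongr
        exact PadicInt.norm_le_one _
    _ < ‖(2 : ℤ_[q])‖ ^ 2 * 1 := by
        rw [mul_one]
        exact mul_lt_mul_of_pos_left hq h2
    _ = ‖(2 : ℤ_[q])‖ ^ 2 := mul_one _

/-- **Hensel at `X² − d`, `a = 1`.**  If `4q ∣ d − 1` then `d` is a square in `ℚ_q`: `‖F(1)‖ = ‖1 − d‖ < ‖F′(1)‖² = ‖2‖²` for `F = X² − d ∈ ℤ[X]`
(`norm_natCast_sub_one_lt`), so Mathlib's `hensels_lemma` yields `z ∈ ℤ_q` with `z² = d`, and `(z : ℚ_q)² = d`.  At `q` odd this is «a unit which is a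
square mod `q` is a square», at `q = 2` «a unit `≡ 1 (mod 8)` is a square» (Serre, Cours d'arithmétique II §3.3).  [folklore] -/
theorem isSquare_padic_natCast_of_dvd {q : ℕ} [Fact q.Prime] {d : ℕ} (h : (4 * (q : ℤ)) ∣ (d : ℤ) - 1) :
    IsSquare ((d : ℕ) : ℚ_[q]) := by
  set F : ℤ[X] := X ^ 2 - C (d : ℤ) with hF
  have hFa : F.aeval (1 : ℤ_[q]) = 1 - (d : ℤ_[q]) := by
    simp [hF]
  have hF'a : F.derivative.aeval (1 : ℤ_[q]) = 2 := by
    rw [hF, derivative_sub, derivative_X_sq, derivative_C, sub_zero, map_mul, aeval_C, aeval_X, mul_one]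
    simp
  have hnorm : ‖F.aeval (1 : ℤ_[q])‖ < ‖F.derivative.aeval (1 : ℤ_[q])‖ ^ 2 := by
    rw [hFa, hF'a, norm_sub_rev]
    exact norm_natCast_sub_one_lt h
  obtain ⟨z, hz, -⟩ := hensels_lemma hnorm
  have hz2 : z ^ 2 = (d : ℤ_[q]) := by
    have : z ^ 2 - (d : ℤ_[q]) = 0 := by simpa [hF] using hz
    exact sub_eq_zero.mp this
  refine ⟨(z : ℚ_[q]), ?_⟩
  have hq : ((z ^ 2 : ℤ_[q]) : ℚ_[q]) = ((d : ℤ_[q]) : ℚ_[q]) := congrArg ((↑) : ℤ_[q] → ℚ_[q]) hz2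
  rw [PadicInt.coe_pow, PadicInt.coe_natCast, sq] at hq
  exact hq.symm

/-! ## §2 The dealt statement: `d ≡ 1 (mod 8p)` is a square in `ℚ_p` and in `ℚ_2` -/

/-- **`K2E1RealQuadraticSplitAtP` (dealt BY NAME, K2E1-plan (g0) 2026-09-03T21:12:14Z; instance binder `[Fact p.Prime]` for the dictated
`p.Prime →`, see the module docstring).**  For a prime `p` and a squarefree `d ≡ 1 (mod 8p)`, `d` is a square in `ℚ_p` and in `ℚ_2` — i.e. `p` and `2`
split in the real quadratic field `ℚ(√d)` (for `d > 1`).  Proof: `8p ∣ d − 1` gives `4p ∣ d − 1` and `4·2 ∣ d − 1`; apply `isSquare_padic_natCast_of_dvd`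
at `q = p` and at `q = 2`.  The `Squarefree d` hypothesis is not used for this conclusion.  [folklore] -/
theorem RealQuadraticSplitAtP :
    ∀ p d : ℕ, [Fact p.Prime] → Squarefree d → d ≡ 1 [MOD 8 * p] →
      IsSquare ((d : ℕ) : ℚ_[p]) ∧ IsSquare ((d : ℕ) : ℚ_[2]) := by
  intro p d _ _ h
  have h8p : ((8 * p : ℕ) : ℤ) ∣ (d : ℤ) - (1 : ℕ) := (Nat.modEq_iff_dvd.1 h.symm)
  push_cast at h8p
  refine ⟨isSquare_padic_natCast_of_dvd (dvd_trans ⟨2, by ring⟩ h8p),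
    isSquare_padic_natCast_of_dvd (dvd_trans ⟨(p : ℤ), by push_cast; ring⟩ h8p)⟩

/-- **Literal-binder variant** of `RealQuadraticSplitAtP`: the dictated `∀ p d : ℕ, p.Prime → …` with the `Fact` instance that `ℚ_[p]` needs supplied
inside the type from the hypothesis `hp` (`haveI`).  Same content; provided so that HELD row 21 may quote either binder.  [folklore] -/
theorem RealQuadraticSplitAtP' :
    ∀ (p d : ℕ) (hp : p.Prime), Squarefree d → d ≡ 1 [MOD 8 * p] →
      (haveI : Fact p.Prime := ⟨hp⟩; IsSquare ((d : ℕ) : ℚ_[p]) ∧ IsSquare ((d : ℕ) : ℚ_[2])) := by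
  intro p d hp hd h
  haveI : Fact p.Prime := ⟨hp⟩
  exact RealQuadraticSplitAtP p d hd h

end Summit.HodgeConjecture.HodgeConjecture.Cruxes.H413.K2E1RealQuadraticSplitAtP
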